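import Summits.BirchSwinnertonDyer.BirchSwinnertonDyer.Theorems.SchneiderFreeAdditiveX3PoitouTatePresentationReadout
import Literature.NumberTheory.GaloisRepresentations.HomDualLocalPairing
import HarnessLib

/-!
# Poitou–Tate toolkit: hypothesis (R4) of the presentation road from an E-side RECIPROCITY SUM with native local terms

Cell `bsd-schneider-ideate`, seat `bsd-schneider-door-c6` (prover, generation 17).  PARTITION: board row
B6 ∩ X3 ∩ sst-twist, `r = 1`, of `Rank1Residual.partition` — CONTROL corner (crux `AnticycControlAdditiveK`,
stmt-BirchSwinnertonDyer-19295; facts binder `ControlFacts` (i) = `poitouTate_selmerStructure_duality K`).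
bears_on: K1-door (r1, B6∩X3-sst) (route-BirchSwinnertonDyer-SchneiderFreeAdditiveX3 item 18969).  THEOREMS ONLY;
closes nothing by itself (BSD is not advanced; no case of Poitou–Tate is proved here).

The last open hypothesis of `poitouTate_selmerStructure_duality_of_assembly` (`…PoitouTatePresentationReadout`) besides
the Tate-duality record and the idèle assembly is (R4), the PAIRING DICTIONARY: the local Tate pairings of the readout
`(R_v f)_v` against a global class detect `inv(ŷ ∘ ∂(f ≫ g))`.  Milne's computation (ADT I, proof of Thm. 4.10, p. 58;
door-c6 g16 FINDING §2) has an idèle/E-side half — the reciprocity sum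
`inv(ŷ ∘ ∂(f ≫ g)) = Σ_v inv_{K_v}((π_v ∘ f)_* δ₁^{K_v}(loc_v y))` for a native representative `y` of `ŷ` (Tate VII §11.2
(bis), door-c5's `classInvAll = Σ_v localInvAt`, F7-dict) — and a native-local half, DONE at the finite places by
`HomDual.zmodToQmodZ_localTatePairingZMod_localReadout` (`HomDualLocalPairing`, this generation):
`(1/n)·⟨R_v f, y_v⟩_v = − inv_{K_v}((π_v ∘ f)_* δ₁^{K_v}(H¹(κ) y_v))`.

* **`hR4_of_localTerms`** — (R4) for the readout `R_v = HomDual.readout ρ₀ n hM (π v)` and an arbitrary invariant map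
  `inv`, FROM the E-side statement «for every `f`, `ŷ`, `T₀` there are a global class `y ∈ H¹(K, M₀^{DD})`, unramified
  outside a finite `Ty ⊇ T₀`, such that for every finite `T' ⊇ Ty`, `inv(ŷ ∘ ∂(f ≫ g))` is the sum over `T'` of the LOCAL
  TERMS: at a finite `v`, `− inv_{K_v}((π_v ∘ f)_* δ₁^{K_v}(H¹(κ)(loc_v y)))` (`brauerInvariantEquiv`, native `δ₁` of the
  restricted presentation); at an infinite `w`, `(1/n)·⟨R_w f, loc_w y⟩_w` (left untranslated: the archimedean dictionary
  is not in the tree in native form)», for any inverse-of-biduality `κ` (`Φ f = f (κ Φ)`).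
* **`poitouTate_selmerStructure_duality_of_localTerms`** — hE from {`TateDualityHypotheses (classBarD K) inv`, an idèle
  projection family with the ASSEMBLY property, the E-side reciprocity sum}.

References: [MilneADT2006] I Thm. 4.10 (b) (proof, p. 58), Lemma 4.13, I §1; [CasselsFrohlichANT1967] Ch. VII §11.2 (bis);
[NeukirchSchmidtWingberg2008] (1.4.2)–(1.4.4), (8.1.17).
-/

noncomputable section

open Function NumberField IsDedekindDomain CategoryTheory CategoryTheory.Abelian
open scoped NumberField ContRepresentation

set_option linter.dupNamespace false
set_option autoImplicit false

namespace Summit.BirchSwinnertonDyer.BirchSwinnertonDyer.Theorems.SchneiderFreeAdditiveX3.PoitouTateReduction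

open Field
open Literature.NumberTheory.GaloisRepresentations Literature.NumberTheory.GaloisCohomology
open Literature.NumberTheory.GaloisRepresentations.DiscreteGaloisModule (mu TateDual tateDual
  localTatePairingZMod unramifiedSubgroup)
open Literature.Algebra.Homology Literature.Algebra.Homology.DiscreteRep Literature.Algebra.Homology.ExtPresentation
open Literature.NumberTheory.GaloisRepresentations.IdeleClassBar (classBarD)
open Literature.NumberTheory.GaloisRepresentations.FreePresentation (presentationComplex presentationComplex_shortExact
  presModule₁ presModule₂ presIncl presProj pres_isSES moduleFinite_presModule₁ moduleFinite_presModule₂)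
open Literature.NumberTheory.GaloisRepresentations.HomDual (IdeleProjection readout readoutInvariant localReadout
  readout_eq_localReadout charZero_of_algebra equivariantMap restrictIntertwining isSES_restrict
  zmodToQmodZ_localTatePairingZMod_localReadout)
open Literature.NumberTheory.GaloisRepresentations.DGMBridge (LCarrier)
open Literature.AnabelianGeometry.AbsoluteAnabelian.Prop121vii (zmodToQmodZ brauerInvariantEquiv)

variable {K : Type} [Field K] [NumberField K]
variable (inv : Abelian.Ext (triv (Γ := absoluteGaloisGroup K) ℤ) (classBarD K) 2 →+ AddCircle (1 : ℚ))

/-- **(R4) for the readout from the E-side reciprocity sum with native local terms** (finite places translated by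
`zmodToQmodZ_localTatePairingZMod_localReadout`; infinite places left as the local Tate pairing itself).
[cite: MilneADT2006, Ch. I, Thm. 4.10(b) (proof, p. 58), §1][cite: CasselsFrohlichANT1967, Ch. VII §11.2 (bis)] -/
theorem hR4_of_localTerms (π : ∀ v : Place K, IdeleProjection K v)
    {n : ℕ} [NeZero n] {M : Type} [AddCommGroup M] [TopologicalSpace M] [DiscreteTopology M] [Finite M]
    [Finite (TateDual K M n)] (ρ₀ : DiscreteGaloisModule K M) (hM : ∀ m : M, n • m = 0)
    (κ : ((ρ₀.tateDual n).tateDual n).toContRepresentation →ⁱL ρ₀.toContRepresentation)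
    (hκ : ∀ (Φ : TateDual K (TateDual K M n) n) (f : TateDual K M n), Φ f = f (κ Φ))
    (hE : ∀ (f : (presentationComplex ρ₀).X₁ ⟶ (ideleClassLimitShortComplex K).X₂)
      (ŷ : Abelian.Ext (triv (Γ := absoluteGaloisGroup K) ℤ) (presentationComplex ρ₀).X₃ 1) (T₀ : Finset (Place K)),
      ∃ (y : galoisCohomology ((ρ₀.tateDual n).tateDual n) 1) (Ty : Finset (Place K)), T₀ ⊆ Ty ∧
        (∀ v : HeightOneSpectrum (𝓞 K), (Sum.inr v : Place K) ∉ Ty →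
          galoisCohomology.localization ((ρ₀.tateDual n).tateDual n) (Sum.inr v) 1 y ∈
            unramifiedSubgroup (GaloisRep.toLocal v ((ρ₀.tateDual n).tateDual n)) 1) ∧
        ∀ T' : Finset (Place K), Ty ⊆ T' →
          inv (ŷ.comp (boundary (presentationComplex_shortExact ρ₀) (classBarD K)
            (f ≫ (ideleClassLimitShortComplex K).g)) (rfl : 1 + 1 = 2)) =
          ∑ v ∈ T', Sum.elim
            (fun w : InfinitePlace K => zmodToQmodZ n
              (localTatePairingZMod (ρ₀.tateDual n) n (Sum.inl w) (LocalInvariants.canonical K n (Sum.inl w))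
                (readout ρ₀ n hM (π (Sum.inl w)) f)
                (galoisCohomology.localization ((ρ₀.tateDual n).tateDual n) (Sum.inl w) 1 y)))
            (fun v : HeightOneSpectrum (𝓞 K) =>
              haveI := moduleFinite_presModule₁ ρ₀
              haveI := moduleFinite_presModule₂ ρ₀
              haveI : CharZero (v.adicCompletion K) := charZero_of_algebra (K := K) (v.adicCompletion K);
              - brauerInvariantEquiv (v.adicCompletion K)
                (cohomologyMap (toTopRepHom ((presModule₁ ρ₀).restrictField (v.adicCompletion K))
                    (DiscreteGaloisModule.units (v.adicCompletion K))
                    (equivariantMap ((presModule₁ ρ₀).restrictField (v.adicCompletion K))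
                      (DiscreteGaloisModule.units (v.adicCompletion K))
                      (readoutInvariant (π (Sum.inr v)) (presentationComplex ρ₀).X₁ f))) 2
                  ((isSES_restrict (presModule₁ ρ₀) (presModule₂ ρ₀) ρ₀ (pres_isSES ρ₀) (K' := v.adicCompletion K)).δ₁
                    (galoisCohomology.map (κ.restrictField (v.adicCompletion K)) 1
                      (galoisCohomology.localization ((ρ₀.tateDual n).tateDual n) (Sum.inr v) 1 y)))))
            v) :
    ∀ (f : (presentationComplex ρ₀).X₁ ⟶ (ideleClassLimitShortComplex K).X₂)
      (ŷ : Abelian.Ext (triv (Γ := absoluteGaloisGroup K) ℤ) (presentationComplex ρ₀).X₃ 1) (T₀ : Finset (Place K)),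
      ∃ (y : galoisCohomology ((ρ₀.tateDual n).tateDual n) 1) (Ty : Finset (Place K)), T₀ ⊆ Ty ∧
        (∀ v : HeightOneSpectrum (𝓞 K), (Sum.inr v : Place K) ∉ Ty →
          galoisCohomology.localization ((ρ₀.tateDual n).tateDual n) (Sum.inr v) 1 y ∈
            unramifiedSubgroup (GaloisRep.toLocal v ((ρ₀.tateDual n).tateDual n)) 1) ∧
        ((∀ T' : Finset (Place K), Ty ⊆ T' →
            ∑ v ∈ T', localTatePairingZMod (ρ₀.tateDual n) n v (LocalInvariants.canonical K n v)
              (readout ρ₀ n hM (π v) f)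
              (galoisCohomology.localization ((ρ₀.tateDual n).tateDual n) v 1 y) = 0) →
          inv (ŷ.comp (boundary (presentationComplex_shortExact ρ₀) (classBarD K)
            (f ≫ (ideleClassLimitShortComplex K).g)) (rfl : 1 + 1 = 2)) = 0) := by
  intro f ŷ T₀
  haveI := moduleFinite_presModule₁ ρ₀
  haveI := moduleFinite_presModule₂ ρ₀
  obtain ⟨y, Ty, hT, hunr, hsum⟩ := hE f ŷ T₀
  refine ⟨y, Ty, hT, hunr, fun hzero => ?_⟩
  rw [hsum Ty le_rfl]
  -- every local term is `zmodToQmodZ` of the corresponding local Tate pairing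
  have hterm : ∀ v ∈ Ty, (Sum.elim
      (fun w : InfinitePlace K => zmodToQmodZ n
        (localTatePairingZMod (ρ₀.tateDual n) n (Sum.inl w) (LocalInvariants.canonical K n (Sum.inl w))
          (readout ρ₀ n hM (π (Sum.inl w)) f)
          (galoisCohomology.localization ((ρ₀.tateDual n).tateDual n) (Sum.inl w) 1 y)))
      (fun v : HeightOneSpectrum (𝓞 K) =>
        haveI := moduleFinite_presModule₁ ρ₀
        haveI := moduleFinite_presModule₂ ρ₀
        haveI : CharZero (v.adicCompletion K) := charZero_of_algebra (K := K) (v.adicCompletion K);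
        - brauerInvariantEquiv (v.adicCompletion K)
          (cohomologyMap (toTopRepHom ((presModule₁ ρ₀).restrictField (v.adicCompletion K))
              (DiscreteGaloisModule.units (v.adicCompletion K))
              (equivariantMap ((presModule₁ ρ₀).restrictField (v.adicCompletion K))
                (DiscreteGaloisModule.units (v.adicCompletion K))
                (readoutInvariant (π (Sum.inr v)) (presentationComplex ρ₀).X₁ f))) 2
            ((isSES_restrict (presModule₁ ρ₀) (presModule₂ ρ₀) ρ₀ (pres_isSES ρ₀) (K' := v.adicCompletion K)).δ₁
              (galoisCohomology.map (κ.restrictField (v.adicCompletion K)) 1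
                (galoisCohomology.localization ((ρ₀.tateDual n).tateDual n) (Sum.inr v) 1 y)))))
      v : AddCircle (1 : ℚ)) =
      zmodToQmodZ n (localTatePairingZMod (ρ₀.tateDual n) n v (LocalInvariants.canonical K n v)
        (readout ρ₀ n hM (π v) f) (galoisCohomology.localization ((ρ₀.tateDual n).tateDual n) v 1 y)) := by
    rintro (w | v) -
    · rfl
    · haveI : CharZero (v.adicCompletion K) := charZero_of_algebra (K := K) (v.adicCompletion K);
      set yv : galoisCohomology (((ρ₀.tateDual n).tateDual n).restrictField (v.adicCompletion K)) 1 :=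
        galoisCohomology.localization ((ρ₀.tateDual n).tateDual n) (Sum.inr v) 1 y with hyv
      have key := zmodToQmodZ_localTatePairingZMod_localReadout ρ₀ n hM v κ hκ
        (readoutInvariant (π (Sum.inr v)) (presentationComplex ρ₀).X₁ f) yv
      exact key.symm
  rw [Finset.sum_congr rfl hterm, ← map_sum, hzero Ty le_rfl, map_zero]

/-- **THE NAMED FACT `hE` from: Tate duality for `(Γ_K, C̄, inv)`, an idèle projection family with the ASSEMBLY property,
and the E-side RECIPROCITY SUM with native local terms** (`poitouTate_selmerStructure_duality_of_assembly` with (R4) from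
`hR4_of_localTerms`; the inverse-of-biduality `κ` ranges over all maps with `Φ f = f (κ Φ)` — one exists by
`exists_bidual_intertwining`).  HONEST FRAMING: a reduction; the assembly (door-c5) and the reciprocity sum (door-c4/door-c5:
Tate VII §11.2 (bis) for `inv`, the layer bookkeeping of `ŷ`, and the archimedean dictionary) are genuine remaining inputs.
[cite: MilneADT2006, Ch. I, Thm. 4.10(b) (proof, p. 58), Lemma 4.13, Thm. 1.8][cite: CasselsFrohlichANT1967, Ch. VII §11.2 (bis)] -/
theorem poitouTate_selmerStructure_duality_of_localTerms
    (hT : TateDualityHypotheses (classBarD K) inv) (π : ∀ v : Place K, IdeleProjection K v)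
    (hAsm : ∀ (n : ℕ) [NeZero n],
      ∀ ⦃M : Type⦄ [AddCommGroup M] [TopologicalSpace M] [DiscreteTopology M] [Finite M] [Finite (TateDual K M n)]
      (ρ₀ : DiscreteGaloisModule K M) (_hM : ∀ m : M, n • m = 0),
      ∀ (T : Finset (Place K))
        (h : ∀ v : Place K, (haveI := moduleFinite_presModule₁ ρ₀
          (homGaloisModule ((presModule₁ ρ₀).restrictField (Place.Completion v))
            (DiscreteGaloisModule.units (Place.Completion v))).toTopRep.ρ.invariants)),
        (∀ v : HeightOneSpectrum (𝓞 K), (Sum.inr v : Place K) ∉ T → ∀ x : LCarrier (presentationComplex ρ₀).X₁,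
          IsNonarchimedeanLocalField.ordQ (v.adicCompletion K)
            ((show LCarrier (presentationComplex ρ₀).X₁ →ₗ[ℤ] DiscreteGaloisModule.UnitsCarrier (v.adicCompletion K) from
              ((h (Sum.inr v)).1 : DiscreteRep.HomCarrier (LCarrier (presentationComplex ρ₀).X₁)
                (DiscreteGaloisModule.UnitsCarrier (v.adicCompletion K)))) x) = 0) →
        ∃ f : (presentationComplex ρ₀).X₁ ⟶ (ideleClassLimitShortComplex K).X₂, ∀ v : Place K,
          (haveI := moduleFinite_presModule₁ ρ₀; readoutInvariant (π v) (presentationComplex ρ₀).X₁ f) = h v)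
    (hE : ∀ (n : ℕ) [NeZero n],
      ∀ ⦃M : Type⦄ [AddCommGroup M] [TopologicalSpace M] [DiscreteTopology M] [Finite M] [Finite (TateDual K M n)]
      (ρ₀ : DiscreteGaloisModule K M) (hM : ∀ m : M, n • m = 0)
      (κ : ((ρ₀.tateDual n).tateDual n).toContRepresentation →ⁱL ρ₀.toContRepresentation),
      (∀ (Φ : TateDual K (TateDual K M n) n) (f : TateDual K M n), Φ f = f (κ Φ)) →
      ∀ (f : (presentationComplex ρ₀).X₁ ⟶ (ideleClassLimitShortComplex K).X₂)
        (ŷ : Abelian.Ext (triv (Γ := absoluteGaloisGroup K) ℤ) (presentationComplex ρ₀).X₃ 1) (T₀ : Finset (Place K)),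
        ∃ (y : galoisCohomology ((ρ₀.tateDual n).tateDual n) 1) (Ty : Finset (Place K)), T₀ ⊆ Ty ∧
          (∀ v : HeightOneSpectrum (𝓞 K), (Sum.inr v : Place K) ∉ Ty →
            galoisCohomology.localization ((ρ₀.tateDual n).tateDual n) (Sum.inr v) 1 y ∈
              unramifiedSubgroup (GaloisRep.toLocal v ((ρ₀.tateDual n).tateDual n)) 1) ∧
          ∀ T' : Finset (Place K), Ty ⊆ T' →
            inv (ŷ.comp (boundary (presentationComplex_shortExact ρ₀) (classBarD K)
              (f ≫ (ideleClassLimitShortComplex K).g)) (rfl : 1 + 1 = 2)) =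
            ∑ v ∈ T', Sum.elim
              (fun w : InfinitePlace K => zmodToQmodZ n
                (localTatePairingZMod (ρ₀.tateDual n) n (Sum.inl w) (LocalInvariants.canonical K n (Sum.inl w))
                  (readout ρ₀ n hM (π (Sum.inl w)) f)
                  (galoisCohomology.localization ((ρ₀.tateDual n).tateDual n) (Sum.inl w) 1 y)))
              (fun v : HeightOneSpectrum (𝓞 K) =>
                haveI := moduleFinite_presModule₁ ρ₀
                haveI := moduleFinite_presModule₂ ρ₀
                haveI : CharZero (v.adicCompletion K) := charZero_of_algebra (K := K) (v.adicCompletion K);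
                - brauerInvariantEquiv (v.adicCompletion K)
                  (cohomologyMap (toTopRepHom ((presModule₁ ρ₀).restrictField (v.adicCompletion K))
                      (DiscreteGaloisModule.units (v.adicCompletion K))
                      (equivariantMap ((presModule₁ ρ₀).restrictField (v.adicCompletion K))
                        (DiscreteGaloisModule.units (v.adicCompletion K))
                        (readoutInvariant (π (Sum.inr v)) (presentationComplex ρ₀).X₁ f))) 2
                    ((isSES_restrict (presModule₁ ρ₀) (presModule₂ ρ₀) ρ₀ (pres_isSES ρ₀) (K' := v.adicCompletion K)).δ₁
                      (galoisCohomology.map (κ.restrictField (v.adicCompletion K)) 1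
                        (galoisCohomology.localization ((ρ₀.tateDual n).tateDual n) (Sum.inr v) 1 y)))))
              v) :
    poitouTate_selmerStructure_duality K := by
  refine poitouTate_selmerStructure_duality_of_assembly inv hT π hAsm fun n _ M _ _ _ _ _ ρ₀ hM => ?_
  obtain ⟨ι, κ, hι, hκι, hικ⟩ := exists_bidual_intertwining (n := n) ρ₀ hM
  have hκ : ∀ (Φ : TateDual K (TateDual K M n) n) (f : TateDual K M n), Φ f = f (κ Φ) := fun Φ f => by
    conv_lhs => rw [← hικ Φ]
    exact hι (κ Φ) f
  exact hR4_of_localTerms inv π ρ₀ hM κ hκ (hE n ρ₀ hM κ hκ)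

end Summit.BirchSwinnertonDyer.BirchSwinnertonDyer.Theorems.SchneiderFreeAdditiveX3.PoitouTateReduction

end
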